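import Summits.AtomisticToContinuum.HydrodynamicLimit.Theses.BoxDissipativeWeakStrong
import Literature.Analysis.FluidPDE.CollisionalTransferTimeDep
import Summits.AtomisticToContinuum.HydrodynamicLimit.Theorems.BoxDissipativeWeakStrongFluxClosureTdBalanceLawLocal
import Summits.AtomisticToContinuum.HydrodynamicLimit.Theorems.BoxDissipativeWeakStrongFluxClosureBoxAverageFlightDeriv
import Summits.AtomisticToContinuum.HydrodynamicLimit.Theorems.BoxDissipativeWeakStrongFluxClosureBoxStreamingSplit
import Summits.AtomisticToContinuum.HydrodynamicLimit.Theorems.BoxDissipativeWeakStrongFluxClosureBoxIntegrableAlongFlow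
import Summits.AtomisticToContinuum.HydrodynamicLimit.Theorems.BoxDissipativeWeakStrongFluxClosureKinDevAEMeasurable
import Summits.AtomisticToContinuum.HydrodynamicLimit.Theorems.ImplosionDichotomyHydroLimitInBandWindowBalance
import HarnessLib

/-!
# Crux `FluxClosure` (stmt-AtomisticToContinuum-9902, route BoxDissipativeWeakStrong), line `birth`:
# the exact box momentum balance and the reduction of the crux to its two limit statements

Support file (`--supports stmt-AtomisticToContinuum-9902`) of the lead prover of the crux
`Summit.AtomisticToContinuum.HydrodynamicLimit.Theses.BoxDissipativeWeakStrong.FluxClosure`. It moves the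
KERNEL-CHECKED part of the line's skeleton (`Cruxes/FluxClosure/Lines/birth.lean`, r2) into an importable
Theorems module:

* `boxMomentumBalance` — the EXACT BOX MOMENTUM BALANCE IN SPLIT FORM at finite `N` (the birth skeleton's
  stub B, registered as `stub_boxMomentumBalance` by the planner): for every good datum `z` of the hard-sphere
  flow `Φ N`, the crux's pathwise weak momentum-balance defect of the box fields (cube kernel at window
  `ℓ_N`) equals `CollDev_N z + KinDev_N z` — collisional momentum transfer minus cut excess pressure, plus the
  traceless box velocity covariance tested against `∇w` — and `KinDev_N` is a.e.-measurable under the local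
  Gibbs law. Proved from the five landed bookkeeping pieces `FluxClosureB1.stub_tdBalanceLawLocal`
  (localised weak balance law along a trajectory), `FluxClosureB2.stub_boxAverageFlightDeriv` (box averages are
  `C¹` along free flights), `FluxClosureB3.stub_boxStreamingSplit` (fixed-configuration Fubini/linearity),
  `FluxClosureB4.stub_boxIntegrableAlongFlow` (integrability along the orbit), `FluxClosureB5.stub_kinDevAEMeasurable`.
* `stub_fluxClosureOfLimitStubs` — THE GLUE, now a theorem: `KineticIsotropy → CollisionalVirial → FluxClosure`,
  where the two hypotheses are VERBATIM the line's two open limit stubs (`stub_kineticIsotropy`: the kinetic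
  deviation `KinDev_N → 0` in `L¹(P_N)`; `stub_collisionalVirial`: the collisional deviation `CollDev_N → 0` in
  `L¹(P_N)`), i.e. the route header's foreseen two-layer split "FluxClosure ⇐ KineticIsotropy →
  CollisionalVirial → FluxClosure, glue = the exact pathwise momentum balance" with the glue PROVED: merge the
  thresholds (`η_c := min`, `σ₀ := min`), rewrite the defect on the good set (`P_N`-a.e., since
  `localGibbsLaw = particleLaw ≪ liouville` and the good set is Liouville-conull) by `boxMomentumBalance`, and
  run the `L¹(P_N)` triangle inequality for `∫⁻` (`tendsto_lintegral_abs_of_ae_eq_add`).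

Both limit statements are the crux's open physical content (flux-level local equilibrium of DETERMINISTIC hard
spheres at fixed reduced density: no mixing input is known; Spohn 1991 Part I §3.3; Olla–Varadhan–Yau 1993
need noise; `Literature.Barriers.AtomisticToContinuum.BoltzmannHypothesisBarrierNarrow`); this file makes the
crux EQUIVALENT-in-practice to proving them, with nothing else left. No definitions. Sources: H. Spohn,
*Large Scale Dynamics of Interacting Particles* (1991), Part I §3.2–3.3 ((3.3)–(3.8), (3.15)); R. Soto,
*Kinetic Theory and Transport Phenomena* (2016) §4.8.1; J. Březina, E. Feireisl (2018) Def. 2.9.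
-/

noncomputable section

namespace Summit.AtomisticToContinuum.HydrodynamicLimit.Theorems
namespace FluxClosureGlue

open scoped BigOperators Topology Classical MeasureTheory ProbabilityTheory InnerProductSpace ENNReal
open Filter Set Function MeasureTheory
open Literature.MathematicalPhysics.KineticTheory Literature.Analysis.FluidPDE Literature.Analysis.FunctionSpaces
open Summit.AtomisticToContinuum.HydrodynamicLimit.Theses.BoxDissipativeWeakStrong
open Summit.AtomisticToContinuum.HydrodynamicLimit.Theorems.EntropyClockDock (ae_mem_good_localGibbsLaw)

/-- EXACT BOX MOMENTUM BALANCE IN SPLIT FORM (finite `N`, no limit, no threshold; the birth skeleton's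
registered stub B `stub_boxMomentumBalance`, verbatim). For every reduced diameter `σ`, band parameter `η₁`,
horizon `T`, profile functions, flow family `Φ` and windows `ℓ` (`0 < ℓ_N ≤ 1`), every `τ ∈ [0,T)`, every `w`
smooth on `[0,T) × 𝕋³` and every `N`: (i) `KinDev_N` is a.e.-measurable under the local Gibbs law; (ii) for
every GOOD datum `z` of `Φ N`, `D_N z = CollDev_N z + KinDev_N z`. Proof: (i) is `stub_kinDevAEMeasurable`.
(ii): with `γ s := Φ_s z` (a hard-sphere trajectory) and `F t z' := (N+1)⁻¹ momentumObservable (K ⋆ w t) z'`,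
`stub_boxAverageFlightDeriv` summed over the particles gives the three slab hypotheses of
`stub_tdBalanceLawLocal`, which on `[0,τ]` yields `F τ (γ τ) - F 0 (γ 0) = ∫_0^τ F' + C_w`;
`stub_boxStreamingSplit` (a) identifies the boundary terms with `∫⟪m̂, w⟫` and (b) rewrites
`F' s (γ s) = Q s - R s + S s` on `(0,τ]`; `stub_boxIntegrableAlongFlow` splits `∫(Q - R + S)`; `linarith`. -/
theorem boxMomentumBalance : ∀ (σ η₁ T : ℝ) (a₀ θ₀ : T3 → ℝ) (u₀ : T3 → V3) (Φ : (N : ℕ) → HardSphereFlow (Torus.geometry (Fin 3)) (hsDiameter σ N) (N + 1)) (ℓ : ℕ → ℝ), (∀ N, 0 < ℓ N ∧ ℓ N ≤ 1) → let K := fun (l : ℝ) (x y : T3) => indicator {y' : T3 | ∀ i, ‖y' i - x i‖ < l / 2} (fun _ => (l ^ 3)⁻¹) y; let Dn := fun N t z x => empiricalDensityField ((Φ N).flow t z) (K (ℓ N) x); let Mm := fun N t z x => empiricalMomentumField ((Φ N).flow t z) (K (ℓ N) x); let En := fun N t z x => empiricalEnergyField ((Φ N).flow t z) (K (ℓ N)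 x); let Sk := fun N t z x (i j : Fin 3) => ∫ y, K (ℓ N) x y.1 * (y.2 i * y.2 j) ∂(empiricalMeasure ((Φ N).flow t z)); let Th := fun (r : ℝ) (m : V3) (E : ℝ) => 2 / 3 * (E / r - ‖m‖ ^ 2 / (2 * r ^ 2)); let Zc := fun η : ℝ => hsCompressibility (min η η₁); let Pc := fun r ϑ : ℝ => r * ϑ * Zc (r * σ ^ 3); ∀ τ ∈ Ico 0 T, ∀ w : ℝ → T3 → V3, Torus.IsSmoothSpaceTimeOn (Ico 0 T) w → let Cw := fun N (z : Config (N + 1) (Fin 3) T3) => ∑ᶠ t ∈ collisionTimes (Torus.geometry (Fin 3)) (hsDiameter σ N) (fun s => (Φ N).flow s z) ∩ Ioc 0 τ, collisionJump (fun z' : Config (N + 1) (Fin 3) T3 => ((N : ℝ) + 1)⁻¹ * momentumObservable (fun q => ∫ x, K (ℓ N) x q • w t x) z') (fun s => (Φ N).flow s z) t; let KinDev := fun N (z : Config (N + 1) (Fin 3) T3) => ∫ t in Ioc 0 τ, ∫ x, ∑ i, ∑ j, (Sk N t z x i j - Mm N t z x i * Mm N t z x j / Dn N t z x - (if i = j then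 Dn N t z x * Th (Dn N t z x) (Mm N t z x) (En N t z x) else 0)) * Torus.partialDeriv j (fun y => w t y i) x; let CollDev := fun N (z : Config (N + 1) (Fin 3) T3) => Cw N z - ∫ t in Ioc 0 τ, ∫ x, Dn N t z x * Th (Dn N t z x) (Mm N t z x) (En N t z x) * (Zc (Dn N t z x * σ ^ 3) - 1) * Torus.divergence (w t) x; ∀ N : ℕ, AEMeasurable (KinDev N) (localGibbsLaw σ a₀ u₀ θ₀ N (Φ N)) ∧ ∀ z ∈ (Φ N).good, (∫ x, inner ℝ (Mm N τ z x) (w τ x)) - (∫ x, inner ℝ (Mm N 0 z x) (w 0 x)) - (∫ t in Ioc 0 τ, ∫ x, (inner ℝ (Mm N t z x) (Torus.timeDerivWithin (Ico 0 T) w t x) + (∑ i, ∑ j, Mm N t z x i * Mm N t z x j / Dn N t z x * Torus.partialDeriv j (fun y => w t y i) x) + Pc (Dn N t z x) (Th (Dn N t z x) (Mm N t z x) (En N t z x)) * Torus.divergence (w t) x)) = CollDev N z + KinDev N z := by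
  have S1 := FluxClosureB1.stub_tdBalanceLawLocal
  have S2 := FluxClosureB2.stub_boxAverageFlightDeriv
  have S3 := FluxClosureB3.stub_boxStreamingSplit
  have S4 := FluxClosureB4.stub_boxIntegrableAlongFlow
  have S5 := FluxClosureB5.stub_kinDevAEMeasurable
  revert S1 S2 S3 S4 S5
  intro S1 S2 S3 S4 S5 σ η₁ T a₀ θ₀ u₀ Φ ℓ hℓ
  dsimp only
  intro τ hτ w hw N
  have hT : (0 : ℝ) < T := lt_of_le_of_lt hτ.1 hτ.2
  refine ⟨?_, ?_⟩
  · have h5 := S5 σ T a₀ θ₀ u₀ Φ ℓ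
    dsimp only at h5
    exact h5 τ hτ w hw N
  · intro z hz
    have h4 := S4 σ η₁ T Φ ℓ hℓ
    dsimp only at h4
    obtain ⟨hQ, hR, hS⟩ := h4 τ hτ w hw N z hz
    have h2 := S2 (ℓ N) T (hℓ N).1 w hw
    dsimp only at h2
    have h3 := S3 σ η₁ T (ℓ N) (hℓ N).1 (hℓ N).2 w hw N
    dsimp only at h3
    clear S2 S3 S4 S5 h4
    have hγ : IsHardSphereTrajectory (Torus.geometry (Fin 3)) (hsDiameter σ N) (N + 1)
        (fun s => (Φ N).flow s z) := (Φ N).isTrajectory z hz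
    -- the box-averaged momentum observable and its streaming derivative (particle level)
    let F : ℝ → Config (N + 1) (Fin 3) T3 → ℝ := fun (t : ℝ) (z' : Config (N + 1) (Fin 3) T3) => ((N : ℝ) + 1)⁻¹ * momentumObservable (fun q => ∫ x, indicator {y' : T3 | ∀ i, ‖y' i - x i‖ < ℓ N / 2} (fun _ => (ℓ N ^ 3)⁻¹) q • w t x) z'
    let F' : ℝ → Config (N + 1) (Fin 3) T3 → ℝ := fun (t : ℝ) (z' : Config (N + 1) (Fin 3) T3) => ((N : ℝ) + 1)⁻¹ * ∑ i, (inner ℝ (∫ x, indicator {y' : T3 | ∀ i, ‖y' i - x i‖ < ℓ N / 2} (fun _ => (ℓ N ^ 3)⁻¹) (z' i).1 • Torus.timeDerivWithin (Ico 0 T) w t x) (z' i).2 + ∑ j, ∑ k, (z' i).2 j * (z' i).2 k * ∫ x, indicator {y' : T3 | ∀ i, ‖y' i - x i‖ < ℓ N / 2} (fun _ => (ℓ N ^ 3)⁻¹) (z' i).1 * Torus.partialDeriv k (fun y => w t y j) x)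
    have hcont : ∀ (z' : Config (N + 1) (Fin 3) T3) (t₀ : ℝ),
        ContinuousOn (fun s => F s (freeFlight (Torus.geometry (Fin 3)) (s - t₀) z')) (Ico 0 T) := by
      intro z' t₀
      simp only [F, momentumObservable, freeFlight_apply, Torus.geometry_translate]
      exact continuousOn_const.mul (continuousOn_finsetSum _ fun i _ => (h2 (z' i).1 (z' i).2 t₀).1)
    have hderiv : ∀ (z' : Config (N + 1) (Fin 3) T3) (t₀ : ℝ), ∀ t ∈ Ioo 0 T,
        HasDerivAt (fun s => F s (freeFlight (Torus.geometry (Fin 3)) (s - t₀) z'))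
          (F' t (freeFlight (Torus.geometry (Fin 3)) (t - t₀) z')) t := by
      intro z' t₀ t ht
      simp only [F, F', momentumObservable, freeFlight_apply, Torus.geometry_translate]
      exact (HasDerivAt.fun_sum fun i _ => (h2 (z' i).1 (z' i).2 t₀).2.1 t ht).const_mul _
    have hF'cont : ∀ (z' : Config (N + 1) (Fin 3) T3) (t₀ : ℝ),
        ContinuousOn (fun t => F' t (freeFlight (Torus.geometry (Fin 3)) (t - t₀) z')) (Ico 0 T) := by
      intro z' t₀
      simp only [F', freeFlight_apply, Torus.geometry_translate]
      exact continuousOn_const.mul (continuousOn_finsetSum _ fun i _ => (h2 (z' i).1 (z' i).2 t₀).2.2)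
    obtain ⟨-, hbal⟩ := S1 (N + 1) (hsDiameter σ N) (fun s => (Φ N).flow s z) hγ T F F' hcont hderiv hF'cont
      0 τ le_rfl hτ.1 hτ.2
    clear hcont hderiv hF'cont S1
    -- boundary terms
    have hbτ := (h3 ((Φ N).flow τ z) τ hτ).1
    have hb0 := (h3 ((Φ N).flow 0 z) 0 ⟨le_rfl, hT⟩).1
    -- name the three box functionals along the orbit
    set Q : ℝ → ℝ := fun t => ∫ x, (inner ℝ (empiricalMomentumField ((Φ N).flow t z) (fun y => indicator {y' : T3 | ∀ i, ‖y' i - x i‖ < ℓ N / 2} (fun _ => (ℓ N ^ 3)⁻¹) y)) (Torus.timeDerivWithin (Ico 0 T) w t x) + (∑ i, ∑ j, empiricalMomentumField ((Φ N).flow t z) (fun y => indicator {y' : T3 | ∀ i, ‖y' i - x i‖ < ℓ N / 2} (fun _ => (ℓ N ^ 3)⁻¹) y) i * empiricalMomentumField ((Φ N).flow t z) (fun y => indicator {y' : T3 | ∀ i, ‖y' i - x i‖ < ℓ N / 2} (fun _ => (ℓ N ^ 3)⁻¹) y) j / empiricalDensityField ((Φ N).flow t z) (fun y => indicator {y' :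 T3 | ∀ i, ‖y' i - x i‖ < ℓ N / 2} (fun _ => (ℓ N ^ 3)⁻¹) y) * Torus.partialDeriv j (fun y => w t y i) x) + empiricalDensityField ((Φ N).flow t z) (fun y => indicator {y' : T3 | ∀ i, ‖y' i - x i‖ < ℓ N / 2} (fun _ => (ℓ N ^ 3)⁻¹) y) * (2 / 3 * (empiricalEnergyField ((Φ N).flow t z) (fun y => indicator {y' : T3 | ∀ i, ‖y' i - x i‖ < ℓ N / 2} (fun _ => (ℓ N ^ 3)⁻¹) y) / empiricalDensityField ((Φ N).flow t z) (fun y => indicator {y' : T3 | ∀ i, ‖y' i - x i‖ < ℓ N / 2} (fun _ => (ℓ N ^ 3)⁻¹) y) - ‖empiricalMomentumField ((Φ N).flow t z) (fun y => indicator {y' : T3 | ∀ i, ‖y' i - x i‖ < ℓ N / 2} (fun _ => (ℓ N ^ 3)⁻¹) y)‖ ^ 2 / (2 * empiricalDensityField ((Φ N).flow t z) (fun y => indicator {y' : T3 | ∀ i, ‖y' i - x i‖ < ℓ N / 2} (fun _ => (ℓ N ^ 3)⁻¹) y) ^ 2))) * hsCompressibility (min (empiricalDensityField ((Φ N).flow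 t z) (fun y => indicator {y' : T3 | ∀ i, ‖y' i - x i‖ < ℓ N / 2} (fun _ => (ℓ N ^ 3)⁻¹) y) * σ ^ 3) η₁) * Torus.divergence (w t) x) with hQdef
    set R : ℝ → ℝ := fun t => ∫ x, empiricalDensityField ((Φ N).flow t z) (fun y => indicator {y' : T3 | ∀ i, ‖y' i - x i‖ < ℓ N / 2} (fun _ => (ℓ N ^ 3)⁻¹) y) * (2 / 3 * (empiricalEnergyField ((Φ N).flow t z) (fun y => indicator {y' : T3 | ∀ i, ‖y' i - x i‖ < ℓ N / 2} (fun _ => (ℓ N ^ 3)⁻¹) y) / empiricalDensityField ((Φ N).flow t z) (fun y => indicator {y' : T3 | ∀ i, ‖y' i - x i‖ < ℓ N / 2} (fun _ => (ℓ N ^ 3)⁻¹) y) - ‖empiricalMomentumField ((Φ N).flow t z) (fun y => indicator {y' : T3 | ∀ i, ‖y' i - x i‖ < ℓ N / 2} (fun _ => (ℓ N ^ 3)⁻¹) y)‖ ^ 2 / (2 * empiricalDensityField ((Φ N).flow t z) (fun y => indicator {y' : T3 | ∀ i, ‖y' i - x i‖ < ℓ N / 2} (fun _ => (ℓ N ^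 3)⁻¹) y) ^ 2))) * (hsCompressibility (min (empiricalDensityField ((Φ N).flow t z) (fun y => indicator {y' : T3 | ∀ i, ‖y' i - x i‖ < ℓ N / 2} (fun _ => (ℓ N ^ 3)⁻¹) y) * σ ^ 3) η₁) - 1) * Torus.divergence (w t) x with hRdef
    set S : ℝ → ℝ := fun t => ∫ x, ∑ i, ∑ j, ((∫ y, indicator {y' : T3 | ∀ i, ‖y' i - x i‖ < ℓ N / 2} (fun _ => (ℓ N ^ 3)⁻¹) y.1 * (y.2 i * y.2 j) ∂(empiricalMeasure ((Φ N).flow t z))) - empiricalMomentumField ((Φ N).flow t z) (fun y => indicator {y' : T3 | ∀ i, ‖y' i - x i‖ < ℓ N / 2} (fun _ => (ℓ N ^ 3)⁻¹) y) i * empiricalMomentumField ((Φ N).flow t z) (fun y => indicator {y' : T3 | ∀ i, ‖y' i - x i‖ < ℓ N / 2} (fun _ => (ℓ N ^ 3)⁻¹) y) j / empiricalDensityField ((Φ N).flow t z) (fun y => indicator {y' : T3 | ∀ i, ‖y' i - x i‖ < ℓ N / 2} (fun _ => (ℓ N ^ 3)⁻¹) y) - (if i = j then empiricalDensityField ((Φ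 N).flow t z) (fun y => indicator {y' : T3 | ∀ i, ‖y' i - x i‖ < ℓ N / 2} (fun _ => (ℓ N ^ 3)⁻¹) y) * (2 / 3 * (empiricalEnergyField ((Φ N).flow t z) (fun y => indicator {y' : T3 | ∀ i, ‖y' i - x i‖ < ℓ N / 2} (fun _ => (ℓ N ^ 3)⁻¹) y) / empiricalDensityField ((Φ N).flow t z) (fun y => indicator {y' : T3 | ∀ i, ‖y' i - x i‖ < ℓ N / 2} (fun _ => (ℓ N ^ 3)⁻¹) y) - ‖empiricalMomentumField ((Φ N).flow t z) (fun y => indicator {y' : T3 | ∀ i, ‖y' i - x i‖ < ℓ N / 2} (fun _ => (ℓ N ^ 3)⁻¹) y)‖ ^ 2 / (2 * empiricalDensityField ((Φ N).flow t z) (fun y => indicator {y' : T3 | ∀ i, ‖y' i - x i‖ < ℓ N / 2} (fun _ => (ℓ N ^ 3)⁻¹) y) ^ 2))) else 0)) * Torus.partialDeriv j (fun y => w t y i) x with hSdef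
    -- streaming term on (0, τ]
    have hstream : EqOn (fun s => F' s ((Φ N).flow s z)) (fun t => Q t - R t + S t) (Ioc 0 τ) := by
      intro s hs
      have h := (h3 ((Φ N).flow s z) s ⟨hs.1.le, lt_of_le_of_lt hs.2 hτ.2⟩).2
      simp only [F', hQdef, hRdef, hSdef]
      exact h
    have hP : (∫ s in (0 : ℝ)..τ, F' s ((Φ N).flow s z)) =
        (∫ t in Ioc 0 τ, Q t) - (∫ t in Ioc 0 τ, R t) + ∫ t in Ioc 0 τ, S t := by
      rw [intervalIntegral.integral_of_le hτ.1, setIntegral_congr_fun measurableSet_Ioc hstream,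
        integral_add (hQ.sub' hR) hS, integral_sub hQ hR]
    simp only [F, F'] at hbal hP
    linarith [hbal, hP, hbτ, hb0]

/-- The `L¹(P_N)` triangle inequality behind the glue, in abstract form: if `D_N = X_N + Y_N`
`P_N`-a.e., `Y_N` is `P_N`-a.e.-measurable and `∫⁻|X_N| dP_N → 0`, `∫⁻|Y_N| dP_N → 0`, then
`∫⁻|D_N| dP_N → 0` (lower Lebesgue integrals of `ENNReal.ofReal |·|`; subadditivity of `∫⁻` needs the
measurability of one summand, `lintegral_add_right'`). -/
theorem tendsto_lintegral_abs_of_ae_eq_add {Ω : ℕ → Type*} [∀ N, MeasurableSpace (Ω N)]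
    (P : ∀ N, Measure (Ω N)) (D X Y : ∀ N, Ω N → ℝ)
    (hsplit : ∀ N, ∀ᵐ z ∂P N, D N z = X N z + Y N z)
    (hY : ∀ N, AEMeasurable (Y N) (P N))
    (hX : Tendsto (fun N => ∫⁻ z, ENNReal.ofReal |X N z| ∂P N) atTop (𝓝 0))
    (hY' : Tendsto (fun N => ∫⁻ z, ENNReal.ofReal |Y N z| ∂P N) atTop (𝓝 0)) :
    Tendsto (fun N => ∫⁻ z, ENNReal.ofReal |D N z| ∂P N) atTop (𝓝 0) := by
  have hle : ∀ N, ∫⁻ z, ENNReal.ofReal |D N z| ∂P N ≤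
      (∫⁻ z, ENNReal.ofReal |X N z| ∂P N) + ∫⁻ z, ENNReal.ofReal |Y N z| ∂P N := by
    intro N
    calc ∫⁻ z, ENNReal.ofReal |D N z| ∂P N
        ≤ ∫⁻ z, ENNReal.ofReal |X N z| + ENNReal.ofReal |Y N z| ∂P N := by
          refine lintegral_mono_ae ((hsplit N).mono fun z hz => ?_)
          rw [hz]
          exact (ENNReal.ofReal_le_ofReal (abs_add_le _ _)).trans ENNReal.ofReal_add_le
      _ = (∫⁻ z, ENNReal.ofReal |X N z| ∂P N) + ∫⁻ z, ENNReal.ofReal |Y N z| ∂P N :=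
          lintegral_add_right' _ (continuous_abs.measurable.comp_aemeasurable (hY N)).ennreal_ofReal
  have hsum : Tendsto (fun N => (∫⁻ z, ENNReal.ofReal |X N z| ∂P N) +
      ∫⁻ z, ENNReal.ofReal |Y N z| ∂P N) atTop (𝓝 0) := by
    simpa using hX.add hY'
  exact tendsto_of_tendsto_of_tendsto_of_le_of_le tendsto_const_nhds hsum (fun N => zero_le) hle

set_option maxHeartbeats 800000 in
/-- THE GLUE OF LINE `birth`, PROVED: the crux `FluxClosure` follows from its two open limit statements —
KINETIC ISOTROPY (`stub_kineticIsotropy`: the traceless box velocity covariance tested against `∇w`,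
integrated over `(0,τ] × 𝕋³`, tends to `0` in `L¹(P_N)`) and COLLISIONAL VIRIAL (`stub_collisionalVirial`:
the time-integrated collisional momentum transfer closes on the cut excess pressure `ρ̂θ̂(Z(min(ρ̂σ³,η₁)) - 1)`
in `L¹(P_N)`), both hypotheses being VERBATIM the registered stub signatures (crux frame: EOS fact →
`∃ η_c ∀ η₁ < η_c ∀ profiles ∃ σ₀ ∀ σ < σ₀ ∀ classical solution + guard ∀ Φ, LLN at 0 → ∀ kinetic windows`).
Proof: merge the thresholds (`η_c := min`, `σ₀ := min`), instantiate `boxMomentumBalance` at the same data,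
and apply `tendsto_lintegral_abs_of_ae_eq_add` with `P_N := localGibbsLaw`, the split holding `P_N`-a.e.
because `P_N`-a.e. datum is good (`EntropyClockDock.ae_mem_good_localGibbsLaw`). This is the route header's foreseen
two-layer split of `FluxClosure` with its glue discharged. -/
theorem stub_fluxClosureOfLimitStubs : (HsEosLowDensity → ∃ ηc : ℝ, 0 < ηc ∧ ∀ η₁ : ℝ, 0 < η₁ → η₁ < ηc → ∀ (a₀ θ₀ : T3 → ℝ) (u₀ : T3 → V3), Continuous a₀ → Continuous θ₀ → Continuous u₀ → (∀ x, 0 < a₀ x) → (∀ x, 0 < θ₀ x) → ∃ σ₀ : ℝ, 0 < σ₀ ∧ ∀ σ : ℝ, 0 < σ → σ < σ₀ → ∀ (T : ℝ) (ρ θ : ℝ → T3 → ℝ) (u : ℝ → T3 → V3), IsHardSphereEulerSolution σ T ρ u θ → (∀ t ∈ Ico 0 T, ∀ x, ρ t x * σ ^ 3 ≤ η₁ / 2) → ∀ Φ : (N : ℕ) → HardSphereFlow (Torus.geometry (Fin 3)) (hsDiameter σ N) (N + 1), TendstoHydroFieldsAt (fun N => localGibbsLaw σ a₀ u₀ θ₀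 N (Φ N)) Φ ρ u θ 0 → ∀ ℓ : ℕ → ℝ, (∀ N, 0 < ℓ N ∧ ℓ N ≤ 1) → Tendsto ℓ atTop (𝓝 0) → Tendsto (fun N : ℕ => ℓ N ^ 3 * ((N : ℝ) + 1)) atTop atTop → let K := fun (l : ℝ) (x y : T3) => indicator {y' : T3 | ∀ i, ‖y' i - x i‖ < l / 2} (fun _ => (l ^ 3)⁻¹) y; let Dn := fun N t z x => empiricalDensityField ((Φ N).flow t z) (K (ℓ N) x); let Mm := fun N t z x => empiricalMomentumField ((Φ N).flow t z) (K (ℓ N) x); let En := fun N t z x => empiricalEnergyField ((Φ N).flow t z) (K (ℓ N) x); let Sk := fun N t z x (i j : Fin 3) => ∫ y, K (ℓ N) x y.1 * (y.2 i * y.2 j) ∂(empiricalMeasure ((Φ N).flow t z)); let Th := fun (r : ℝ) (m : V3) (E : ℝ) => 2 / 3 * (E / r - ‖m‖ ^ 2 / (2 * r ^ 2)); ∀ τ ∈ Ico 0 T, ∀ w : ℝ → T3 → V3, Torus.IsSmoothSpaceTimeOn (Ico 0 T) w → Tendsto (fun N : ℕ => ∫⁻ z, ENNReal.ofReal (|∫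 t in Ioc 0 τ, ∫ x, ∑ i, ∑ j, (Sk N t z x i j - Mm N t z x i * Mm N t z x j / Dn N t z x - (if i = j then Dn N t z x * Th (Dn N t z x) (Mm N t z x) (En N t z x) else 0)) * Torus.partialDeriv j (fun y => w t y i) x|) ∂(localGibbsLaw σ a₀ u₀ θ₀ N (Φ N))) atTop (𝓝 0)) → (HsEosLowDensity → ∃ ηc : ℝ, 0 < ηc ∧ ∀ η₁ : ℝ, 0 < η₁ → η₁ < ηc → ∀ (a₀ θ₀ : T3 → ℝ) (u₀ : T3 → V3), Continuous a₀ → Continuous θ₀ → Continuous u₀ → (∀ x, 0 < a₀ x) → (∀ x, 0 < θ₀ x) → ∃ σ₀ : ℝ, 0 < σ₀ ∧ ∀ σ : ℝ, 0 < σ → σ < σ₀ → ∀ (T : ℝ) (ρ θ : ℝ → T3 → ℝ) (u : ℝ → T3 → V3), IsHardSphereEulerSolution σ T ρ u θ → (∀ t ∈ Ico 0 T, ∀ x, ρ t x * σ ^ 3 ≤ η₁ / 2) → ∀ Φ : (N : ℕ) → HardSphereFlow (Torus.geometry (Fin 3)) (hsDiameter σ N) (N + 1), TendstoHydroFieldsAt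 (fun N => localGibbsLaw σ a₀ u₀ θ₀ N (Φ N)) Φ ρ u θ 0 → ∀ ℓ : ℕ → ℝ, (∀ N, 0 < ℓ N ∧ ℓ N ≤ 1) → Tendsto ℓ atTop (𝓝 0) → Tendsto (fun N : ℕ => ℓ N ^ 3 * ((N : ℝ) + 1)) atTop atTop → let K := fun (l : ℝ) (x y : T3) => indicator {y' : T3 | ∀ i, ‖y' i - x i‖ < l / 2} (fun _ => (l ^ 3)⁻¹) y; let Dn := fun N t z x => empiricalDensityField ((Φ N).flow t z) (K (ℓ N) x); let Mm := fun N t z x => empiricalMomentumField ((Φ N).flow t z) (K (ℓ N) x); let En := fun N t z x => empiricalEnergyField ((Φ N).flow t z) (K (ℓ N) x); let Th := fun (r : ℝ) (m : V3) (E : ℝ) => 2 / 3 * (E / r - ‖m‖ ^ 2 / (2 * r ^ 2)); let Zc := fun η : ℝ => hsCompressibility (min η η₁); ∀ τ ∈ Ico 0 T, ∀ w : ℝ → T3 → V3, Torus.IsSmoothSpaceTimeOn (Ico 0 T) w → let Cw := fun N (z : Config (N + 1) (Fin 3) T3) => ∑ᶠ t ∈ collisionTimes (Torus.geometry (Fin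 3)) (hsDiameter σ N) (fun s => (Φ N).flow s z) ∩ Ioc 0 τ, collisionJump (fun z' : Config (N + 1) (Fin 3) T3 => ((N : ℝ) + 1)⁻¹ * momentumObservable (fun q => ∫ x, K (ℓ N) x q • w t x) z') (fun s => (Φ N).flow s z) t; Tendsto (fun N : ℕ => ∫⁻ z, ENNReal.ofReal (|Cw N z - ∫ t in Ioc 0 τ, ∫ x, Dn N t z x * Th (Dn N t z x) (Mm N t z x) (En N t z x) * (Zc (Dn N t z x * σ ^ 3) - 1) * Torus.divergence (w t) x|) ∂(localGibbsLaw σ a₀ u₀ θ₀ N (Φ N))) atTop (𝓝 0)) → FluxClosure := by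
  have hB := boxMomentumBalance
  revert hB
  intro hB hK hV hEos
  obtain ⟨c₁, hc₁, H₁⟩ := hV hEos
  obtain ⟨c₂, hc₂, H₂⟩ := hK hEos
  refine ⟨min c₁ c₂, lt_min hc₁ hc₂, ?_⟩
  intro η₁ hη₁ hη₁c a₀ θ₀ u₀ ha hθ hu ha0 hθ0
  obtain ⟨s₁, hs₁, G₁⟩ :=
    H₁ η₁ hη₁ (lt_of_lt_of_le hη₁c (min_le_left _ _)) a₀ θ₀ u₀ ha hθ hu ha0 hθ0
  obtain ⟨s₂, hs₂, G₂⟩ :=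
    H₂ η₁ hη₁ (lt_of_lt_of_le hη₁c (min_le_right _ _)) a₀ θ₀ u₀ ha hθ hu ha0 hθ0
  refine ⟨min s₁ s₂, lt_min hs₁ hs₂, ?_⟩
  intro σ hσ hσlt T ρ θ u hsol hguard Φ hlln ℓ hℓ hℓ0 hℓ3
  have A := G₁ σ hσ (lt_of_lt_of_le hσlt (min_le_left _ _)) T ρ θ u hsol hguard Φ hlln ℓ hℓ hℓ0 hℓ3
  have B := G₂ σ hσ (lt_of_lt_of_le hσlt (min_le_right _ _)) T ρ θ u hsol hguard Φ hlln ℓ hℓ hℓ0 hℓ3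
  have C := hB σ η₁ T a₀ θ₀ u₀ Φ ℓ hℓ
  dsimp only at A B C ⊢
  intro τ hτ w hw
  have A' := A τ hτ w hw
  have B' := B τ hτ w hw
  have C' := C τ hτ w hw
  refine tendsto_lintegral_abs_of_ae_eq_add (fun N => localGibbsLaw σ a₀ u₀ θ₀ N (Φ N)) _ _ _
    (fun N => ?_) (fun N => (C' N).1) A' B'
  filter_upwards [ae_mem_good_localGibbsLaw σ a₀ θ₀ u₀ N (Φ N)] with z hz
  exact (C' N).2 z hz


end FluxClosureGlue
end Summit.AtomisticToContinuum.HydrodynamicLimit.Theorems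
end
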